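import Literature.AnabelianGeometry.SemiGraphs.TemperedCurveGroupLevelDataNonVacuity2
import Literature.AnabelianGeometry.SemiGraphs.TemperedOrigin
import HarnessLib

/-!
# The Cor. 3.11 cusp leaf of [SemiAnbd] Thm. 6.5 (iii) HOLDS at a CUSPED §6 datum
# (non-vacuity with cusps: `Π^temp = G_{ℚ_p} × F̂₂` with the automorphism-saturated cusp set)

Mochizuki, *Semi-graphs of anabelioids*, Publ. RIMS **42** (2006) [SemiAnbd], §6 Theorem 6.5 (iii) p. 72
(«Every isomorphism of tempered groups `α : Π^temp_{X_K} ⥲ Π^temp_{Y_L}` preserves cuspidal decomposition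
groups and cuspidal geometric decomposition groups»; proof: «Assertion (iii) follows from Corollary 3.11»)
[cite: MochizukiSemiAnbd2006, Thm 6.5(iii) p.72]; §6 p. 71 («`I_x = D_x ∩ Δ^temp_X` is isomorphic to `Ẑ(1)`
… if `x` is a cusp») [cite: MochizukiSemiAnbd2006, §6 p.71].

PROOF-ONLY non-vacuity file (abc-iut cell, layer L3, seat abc-iut-L3-t11 gen 6, NV column of the row
F-1704 / GAP G-L3d2g4-1; no definition, no instance, no named fact).  The tree reduces the printed
Thm. 6.5 (iii) (`TemperedOrigin.CuspidalAbsolutenessHolds`, F-1704) to F-1708, a profinite `Δ̂`-law and ONE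
Cor. 3.11 leaf `h311` (abc-iut-L3-d2, `cuspidalAbsolutenessHolds_of_cor311_of_hatLaw`):
«for certified `X`, `Y`, every `γ : Δ^temp_X ⥲ Δ^temp_Y` carries each cuspidal geometric decomposition
group `I_x ∩ Δ^temp_X` onto a `Π^temp_{Y_L}`-conjugate of some `I_y ∩ Δ^temp_Y`»; seat gen 5 derived `h311`
from the levelwise cusp–graph binder `hLG` (`TemperedCuspidalAbsolutenessOfProCusps.lean`) and certified
`hLG` only at a CUSPLESS datum (`…NonVacuity.lean`).  With cusps present the leaf is NOT automatic:
abc-iut-w5-d040's `exists_temperedCurve_not_isoPreservesCuspidalDecomp` shows that at the genuine-arithmetic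
datum `Π^temp = G_{ℚ_p} × F̂₂` with ONE cusp `I_x = 1 × îa(Ẑ)` the swap of the free generators moves the
cusp class.  Here:

* `TemperedCurve.exists_saturatedCusps` — the SAME group datum (`K = ℚ_p`, `Π^temp := G_{ℚ_p} × F̂₂`,
  augmentation the first projection, itself as profinite completion; bricks of abc-iut-w5-d040 / w5-d218 BY
  NAME) with the closed points := ALL automorphism-translates of the cusp: `Pt := (F̂₂ ≃ₜ* F̂₂)`, every point a
  cusp, `D_φ := G_{ℚ_p} × φ(îa(Ẑ))` (closed; `aug(D_φ) = G_{ℚ_p}` open; `I_φ = 1 × φ(îa(Ẑ)) ≃ₜ* Ẑ`); then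
  `Δ^temp ≅ F̂₂` is NON-ABELIAN and SLIM, every `I_φ` is a PROPER subgroup of `Δ^temp`, and — the point —
  for EVERY `γ : Δ^temp ⥲ Δ^temp` and every cusp `φ` one has `γ(I_φ ∩ Δ^temp) = I_{φ·γ'} ∩ Δ^temp` on the
  nose (`γ'` the transport of `γ` to `F̂₂`), i.e. the cusp family is stable under all automorphisms of the
  topological group `Δ^temp`;
* `TemperedOrigin.exists_principal_inertiaLeaf_cusped` — hence at the principal certificate `Ω := (· = X)`
  of this CUSPED datum the leaf `h311` (displayed with the binder type of
  `cuspidalAbsolutenessHolds_of_cor311_of_hatLaw` / `inertiaLeaf_of_levelwiseCuspGraphIso`, verbatim) HOLDS,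
  with `δ = 1`.

HONEST LABEL.  Consistency evidence for the LEAF at a datum with cusps and non-abelian slim `Δ^temp` —
nothing more: the interface `TemperedCurve p` records no finiteness of the set of cusps, and this datum
saturates the cusp set under `Aut(Δ^temp)` (so many closed points share a decomposition group and Thm. 6.5
(i)/(ii) are not modelled; `Π^temp` is a direct product and compact).  For the tempered fundamental group of
an actual curve the finitely many cusps ARE preserved by every automorphism of `Δ^temp` — that is
Mochizuki's Cor. 3.11/Thm. 6.5 (iii), neither asserted nor questioned here.  The levelwise binder `hLG`
itself is NOT certified at this datum (it needs an Example 3.10 tower whose fibres have open edges — row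
«NV-hLG@cusped», open).  Nothing of [SemiAnbd] is asserted; no side is taken on [IUTchIII] Cor. 3.12.
-/

noncomputable section

open Topology Filter Set Function
open scoped Pointwise
open Literature.IUT.HodgeTheaters (profiniteCompletion toCompletion toCompletion_int_injective)
open Literature.AlgebraicGeometry.Frobenioids (IsSlimGroup)
open Literature.AnabelianGeometry.AbsoluteAnabelian

namespace Literature.AnabelianGeometry.SemiGraphs

/-! ### Bookkeeping (private) -/

/-- Slimness is transported along isomorphisms of topological groups (private copy of the folklore
bookkeeping used in the sibling witness files). [cite: MochizukiSemiAnbd2006, §0 p.6] -/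
private theorem isSlimGroup_of_continuousMulEquiv_sat {G₁ G₂ : Type*} [Group G₁] [TopologicalSpace G₁]
    [Group G₂] [TopologicalSpace G₂] (e : G₁ ≃ₜ* G₂) (h : IsSlimGroup G₁) : IsSlimGroup G₂ := by
  refine ⟨fun H hH => ?_⟩
  refine (Subgroup.eq_bot_iff_forall _).mpr fun z hz => ?_
  have hH' : IsOpen ((H.comap e.toMulEquiv.toMonoidHom : Subgroup G₁) : Set G₁) :=
    hH.preimage e.continuous
  have hz' : e.symm z ∈ Subgroup.centralizer
      ((H.comap e.toMulEquiv.toMonoidHom : Subgroup G₁) : Set G₁) := by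
    refine Subgroup.mem_centralizer_iff.mpr fun g hg => ?_
    have := Subgroup.mem_centralizer_iff.mp hz (e g) hg
    apply e.injective
    simpa [map_mul] using this
  rw [h.centralizer_eq_bot _ hH'] at hz'
  have : e.symm z = 1 := Subgroup.mem_bot.mp hz'
  simpa using congrArg e this

namespace TemperedCurve

/-- **A CUSPED §6 datum whose cusp family is stable under every automorphism of `Δ^temp`.**
`K := ℚ_p`, `Π^temp := G_{ℚ_p} × F̂₂` (augmentation the first projection, itself as profinite completion),
closed points `Pt := (F̂₂ ≃ₜ* F̂₂)`, all cusps, `D_φ := G_{ℚ_p} × φ(îa(Ẑ))`, `I_φ = 1 × φ(îa(Ẑ)) ≃ₜ* Ẑ`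
(`îa` the completion of `k ↦ a^k`, left-inverted by the completed exponent sum `ê_a`).  Recorded:
`K = ℚ_p`, `aug` surjective, a cusp exists and every point is a cusp, `Δ^temp` non-abelian and slim, `Π^temp`
slim, every `I_φ ∩ Δ^temp` is a proper subgroup of `Δ^temp`, and the SATURATION law
`γ(I_x ∩ Δ^temp) = I_y ∩ Δ^temp` (some cusp `y`, for every `γ : Δ^temp ⥲ Δ^temp` and cusp `x`).
Consistency evidence for the interface only (no curve). [cite: MochizukiSemiAnbd2006, §6 p.71] -/
theorem exists_saturatedCusps (p : ℕ) [Fact p.Prime] :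
    ∃ X : TemperedCurve p,
      X.K = ⊥ ∧ Function.Surjective X.aug ∧ Nonempty X.Pt ∧ (∀ x : X.Pt, X.IsCusp x) ∧
      (∃ g ∈ X.DeltaTemp, ∃ h ∈ X.DeltaTemp, g * h ≠ h * g) ∧
      IsSlimGroup X.PiTemp ∧ IsSlimGroup X.DeltaTemp ∧
      (∀ x : X.Pt, (X.inertia x).subgroupOf X.DeltaTemp ≠ ⊤) ∧
      ∀ γ : X.DeltaTemp ≃ₜ* X.DeltaTemp, ∀ x : X.Pt, ∃ y : X.Pt,
        ((X.inertia x).subgroupOf X.DeltaTemp).map γ.toMulEquiv.toMonoidHom =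
          (X.inertia y).subgroupOf X.DeltaTemp := by
  classical
  -- instances on `G_{ℚ_p}`
  haveI : IsGalois ℚ_[p] (AlgebraicClosure ℚ_[p]) := {}
  haveI : T2Space (GQp p) := krullTopology_t2
  -- the profinite data (abc-iut-w5-d218's toolkit, as in abc-iut-w5-d040's witness)
  let P : ProfiniteGrp.{0} := profiniteCompletion (FreeGroup (Fin 2))
  let Zh : ProfiniteGrp.{0} := profiniteCompletion (Multiplicative ℤ)
  let η : FreeGroup (Fin 2) →* P := toCompletion (FreeGroup (Fin 2))
  let ι : Multiplicative ℤ →* Zh := toCompletion (Multiplicative ℤ)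
  let a : FreeGroup (Fin 2) := FreeGroup.of 0
  let b : FreeGroup (Fin 2) := FreeGroup.of 1
  let σa : FreeGroup (Fin 2) →* Multiplicative ℤ :=
    FreeGroup.lift fun j => if j = (0 : Fin 2) then Multiplicative.ofAdd (1 : ℤ) else 1
  have hσaa : σa a = Multiplicative.ofAdd 1 := by simp [σa, a]
  have hσab : σa b = 1 := by simp [σa, b]
  let e : P →ₜ* Zh := (ProfiniteGrp.ProfiniteCompletion.lift (GrpCat.ofHom (ι.comp σa))).hom
  let îa : Zh →ₜ* P :=
    (ProfiniteGrp.ProfiniteCompletion.lift (GrpCat.ofHom (η.comp (zpowersHom _ a)))).hom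
  let îb : Zh →ₜ* P :=
    (ProfiniteGrp.ProfiniteCompletion.lift (GrpCat.ofHom (η.comp (zpowersHom _ b)))).hom
  have he : ∀ g, e (η g) = ι (σa g) := fun g => lift_hom_toCompletion Zh (ι.comp σa) g
  have hîa : ∀ k : ℤ, îa (ι (Multiplicative.ofAdd k)) = η (a ^ k) := fun k => by
    rw [lift_hom_toCompletion P (η.comp (zpowersHom _ a))]
    simp [zpowersHom_apply]
  have hîb : ∀ k : ℤ, îb (ι (Multiplicative.ofAdd k)) = η (b ^ k) := fun k => by
    rw [lift_hom_toCompletion P (η.comp (zpowersHom _ b))]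
    simp [zpowersHom_apply]
  have heîa : ∀ t, e (îa t) = t := TemperedFibreProduct.apply_apply_eq_self_of a σa hσaa e îa he hîa
  have hιinj : Function.Injective ι := toCompletion_int_injective
  -- `η a` and `η b` do not commute: else `η a ∈ C(η b) ⊆ îb(Ẑ)`, and `e` kills `îb(Ẑ)` but not `η a`
  have hnc : η a * η b ≠ η b * η a := by
    intro hab
    have hz' : η a ∈ Subgroup.centralizer ({η (b ^ (1 : ℤ))} : Set P) := by
      rw [zpow_one]; exact Subgroup.mem_centralizer_singleton_iff.mpr hab
    obtain ⟨t, ht⟩ := TemperedFibreProduct.closure_eta_zpowers_subset_range b îb hîb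
      (TemperedFibreProduct.centralizer_eta_of_zpow_subset 1 one_ne_zero hz')
    have h1 : e (η a) = ι (Multiplicative.ofAdd 1) := by rw [he, hσaa]
    have h2 : e (η a) = 1 := by
      rw [← ht]; exact TemperedFibreProduct.apply_apply_eq_one_of b σa hσab e îb he hîb t
    rw [h1, ← map_one ι] at h2
    exact absurd (hιinj h2) (by decide)
  -- `η b ∉ îa(Ẑ)`: `e` is the identity on `îa(Ẑ)` and kills `η b ≠ 1`
  have hηb_ne : η b ≠ 1 := by
    intro h1
    exact hnc (by rw [h1, mul_one, one_mul])
  -- the inertia `I := îa(Ẑ)`, closed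
  let I : Subgroup P := îa.toMonoidHom.range
  have hIclosed : IsClosed (I : Set P) := by
    have : (I : Set P) = Set.range îa := by ext x; simp [I]
    rw [this]; exact (isCompact_range îa.continuous).isClosed
  have hηb_notMem : η b ∉ I := by
    rintro ⟨t, ht⟩
    have h1 : e (η b) = 1 := by rw [he, hσab, map_one]
    have h2 : e (îa t) = t := heîa t
    have h3 : (îa.toMonoidHom t : P) = îa t := rfl
    rw [h3] at ht
    rw [ht] at h2
    rw [h1] at h2
    apply hηb_ne
    rw [← ht, ← h2, map_one]
  -- the group `Π := G_{ℚ_p} × F̂₂`; for `φ : F̂₂ ≃ₜ* F̂₂` the decomposition group `D_φ := G_{ℚ_p} × φ(I)`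
  let D : (P ≃ₜ* P) → Subgroup (GQp p × P) := fun φ =>
    (⊤ : Subgroup (GQp p)).prod (I.comap φ.symm.toMulEquiv.toMonoidHom)
  have hDmem : ∀ (φ : P ≃ₜ* P) (x : GQp p × P), x ∈ D φ ↔ φ.symm x.2 ∈ I := fun φ x => by
    change x ∈ (⊤ : Subgroup (GQp p)).prod (I.comap φ.symm.toMulEquiv.toMonoidHom) ↔ _
    rw [Subgroup.mem_prod, Subgroup.mem_comap]
    exact ⟨fun h => h.2, fun h => ⟨Subgroup.mem_top _, h⟩⟩
  have hDclosed : ∀ φ : P ≃ₜ* P, IsClosed (D φ : Set (GQp p × P)) := fun φ => by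
    have : (D φ : Set (GQp p × P)) = (fun x : GQp p × P => φ.symm x.2) ⁻¹' (I : Set P) := by
      ext x; exact hDmem φ x
    rw [this]; exact hIclosed.preimage (φ.symm.continuous.comp continuous_snd)
  let fstH : GQp p × P →ₜ* GQp p := ContinuousMonoidHom.fst _ _
  have hfstD : ∀ φ : P ≃ₜ* P, fstH '' (D φ : Set (GQp p × P)) = Set.univ := fun φ =>
    Set.eq_univ_of_forall fun g => ⟨(g, 1), (hDmem φ _).2 (by
      change φ.symm 1 ∈ I
      rw [map_one]; exact I.one_mem), rfl⟩
  -- the inertia `D_φ ∩ Ker(pr₁) = 1 × φ(îa(Ẑ)) ≃ₜ* Ẑ` via `ê_a ∘ φ⁻¹`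
  have hinertia : ∀ φ : P ≃ₜ* P, Nonempty (↥(D φ ⊓ fstH.toMonoidHom.ker) ≃ₜ* ZHat) := fun φ => by
    refine ⟨{ toFun := fun x => e (φ.symm x.1.2)
              invFun := fun t => ⟨(1, φ (îa t)), (hDmem φ _).2 (by
                  rw [ContinuousMulEquiv.symm_apply_apply]; exact ⟨t, rfl⟩), (MonoidHom.mem_ker).2 rfl⟩
              left_inv := fun x => ?_
              right_inv := fun t => by
                change e (φ.symm (φ (îa t))) = t
                rw [ContinuousMulEquiv.symm_apply_apply]; exact heîa t
              map_mul' := fun x y => by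
                change e (φ.symm ((x : GQp p × P) * y).2) =
                  e (φ.symm (x : GQp p × P).2) * e (φ.symm (y : GQp p × P).2)
                rw [Prod.snd_mul, map_mul, map_mul]
              continuous_toFun :=
                e.continuous.comp (φ.symm.continuous.comp (continuous_snd.comp continuous_subtype_val))
              continuous_invFun :=
                (continuous_const.prodMk (φ.continuous.comp îa.continuous)).subtype_mk _ }⟩
    obtain ⟨⟨g, z⟩, hgz⟩ := x
    have hg : g = 1 := (MonoidHom.mem_ker).1 (Subgroup.mem_inf.1 hgz).2
    obtain ⟨u, hu⟩ : φ.symm z ∈ I := (hDmem φ _).1 (Subgroup.mem_inf.1 hgz).1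
    apply Subtype.ext
    change ((1 : GQp p), φ (îa (e (φ.symm z)))) = (g, z)
    have hu' : îa u = φ.symm z := hu
    rw [hg, ← hu', heîa u, hu', ContinuousMulEquiv.apply_symm_apply]
  -- the curve-level datum
  let X : TemperedCurve p :=
    { K := ⊥
      finiteDimensional_K := inferInstance
      PiTemp := GQp p × P
      aug := fstH
      range_aug := by
        rw [IntermediateField.fixingSubgroup_bot]
        exact MonoidHom.range_eq_top.mpr Prod.fst_surjective
      PiHat := GQp p × P
      toHat := ContinuousMonoidHom.id _
      isProfiniteCompletion_toHat := isProfiniteCompletion_id _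
      toHat_injective := Function.injective_id
      augHat := fstH
      augHat_comp := fun _ => rfl
      Pt := P ≃ₜ* P
      IsCusp := fun _ => True
      decomp := D
      isClosed_decomp := hDclosed
      isOpen_aug_decomp := fun φ => by
        change IsOpen (fstH '' (D φ : Set (GQp p × P)))
        rw [hfstD]; exact isOpen_univ
      inertia_eq_bot := fun _ h => (h trivial).elim
      inertia_equiv_zHat := fun φ _ => hinertia φ }
  -- group-level facts about `Π = G_{ℚ_p} × F̂₂`
  have hslimP : IsSlimGroup P := isSlimGroup_profiniteCompletion_freeGroupTwo
  have hslimG : IsSlimGroup (GQp p) :=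
    IsSubpadicFor.isSlimGroup_absoluteGaloisGroup (AbsTopIII.IsSubpadicFor.padic p)
  have hslim : IsSlimGroup (GQp p × P) := isSlimGroup_prod_of_profinite hslimG hslimP
  -- `Δ^temp = Ker(pr₁) = 1 × F̂₂ ≃ₜ* F̂₂`, with an EXPLICIT transport `eΔ`
  have hΔmem : ∀ x : GQp p × P, x ∈ X.DeltaTemp ↔ x.1 = 1 := fun x => MonoidHom.mem_ker
  let eΔ : P ≃ₜ* X.DeltaTemp :=
    { toFun := fun z => ⟨(1, z), (hΔmem _).2 rfl⟩
      invFun := fun y => y.1.2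
      left_inv := fun z => rfl
      right_inv := fun y => by
        apply Subtype.ext
        exact Prod.ext ((hΔmem _).1 y.2).symm rfl
      map_mul' := fun z w => Subtype.ext (Prod.ext (mul_one _).symm rfl)
      continuous_toFun := (continuous_const.prodMk continuous_id).subtype_mk _
      continuous_invFun := continuous_snd.comp continuous_subtype_val }
  have hslimΔ : IsSlimGroup X.DeltaTemp := isSlimGroup_of_continuousMulEquiv_sat eΔ hslimP
  -- membership in the inertia groups, read on `Δ^temp`
  have hImem : ∀ (φ : P ≃ₜ* P) (w : X.DeltaTemp),
      (w : GQp p × P) ∈ X.inertia φ ↔ φ.symm (w : GQp p × P).2 ∈ I := fun φ w => by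
    change (w : GQp p × P) ∈ D φ ⊓ X.DeltaTemp ↔ _
    rw [Subgroup.mem_inf, hDmem]
    exact ⟨fun h => h.1, fun h => ⟨h, w.2⟩⟩
  -- non-commutativity inside `Δ^temp`
  have hg : ((1 : GQp p), η a) ∈ X.DeltaTemp := (hΔmem _).2 rfl
  have hh : ((1 : GQp p), η b) ∈ X.DeltaTemp := (hΔmem _).2 rfl
  have hgh : ((1 : GQp p), η a) * ((1 : GQp p), η b) ≠ ((1 : GQp p), η b) * ((1 : GQp p), η a) :=
    fun hc => hnc (by simpa using congrArg Prod.snd hc)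
  refine ⟨X, rfl, Prod.fst_surjective, ⟨ContinuousMulEquiv.refl P⟩, fun _ => trivial,
    ⟨_, hg, _, hh, hgh⟩, hslim, hslimΔ, ?_, ?_⟩
  · -- every `I_φ ∩ Δ^temp` is PROPER: `(1, φ(η b)) ∈ Δ^temp` does not lie in `D_φ` since `η b ∉ îa(Ẑ)`
    intro φ htop
    have hw : (⟨((1 : GQp p), φ (η b)), (hΔmem _).2 rfl⟩ : X.DeltaTemp) ∈
        (X.inertia φ).subgroupOf X.DeltaTemp := by rw [htop]; exact Subgroup.mem_top _
    rw [Subgroup.mem_subgroupOf] at hw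
    have := (hImem φ _).1 hw
    change φ.symm (φ (η b)) ∈ I at this
    rw [ContinuousMulEquiv.symm_apply_apply] at this
    exact hηb_notMem this
  · -- SATURATION: `γ(I_φ ∩ Δ^temp) = I_{φ·γ'} ∩ Δ^temp` with `γ'` the transport of `γ` to `F̂₂`
    intro γ φ
    let γ' : P ≃ₜ* P := eΔ.trans (γ.trans eΔ.symm)
    refine ⟨φ.trans γ', ?_⟩
    ext w
    rw [Subgroup.mem_map_equiv, Subgroup.mem_subgroupOf, Subgroup.mem_subgroupOf, hImem, hImem]
    -- `γ'.symm` restricted along `eΔ` is `γ.symm`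
    have hw1 : (w : GQp p × P).1 = 1 := (hΔmem _).1 w.2
    have heΔw : eΔ (w : GQp p × P).2 = w := by
      apply Subtype.ext
      change ((1 : GQp p), (w : GQp p × P).2) = (w : GQp p × P)
      exact Prod.ext hw1.symm rfl
    have key : (φ.trans γ').symm (w : GQp p × P).2 =
        φ.symm ((γ.toMulEquiv.symm w : X.DeltaTemp) : GQp p × P).2 := by
      change φ.symm (eΔ.symm (γ.symm (eΔ.symm.symm (w : GQp p × P).2))) = _
      rw [ContinuousMulEquiv.symm_symm, heΔw]
      rfl
    rw [key]

end TemperedCurve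

namespace TemperedOrigin

/-- **NON-VACUITY WITH CUSPS of the Cor. 3.11 leaf of Thm. 6.5 (iii)** (GAP G-L3d2g4-1; the binder `h311`
of abc-iut-L3-d2's `cuspidalAbsolutenessHolds_of_cor311_of_hatLaw`, i.e. the conclusion type of seat gen 5's
`inertiaLeaf_of_levelwiseCuspGraphIso`, verbatim): at the principal certificate `Ω := (· = X)` of the cusped
datum of `TemperedCurve.exists_saturatedCusps` (`Π^temp = G_{ℚ_p} × F̂₂`, automorphism-saturated cusp set,
`Δ^temp` non-abelian) the leaf HOLDS — for every `γ : Δ^temp_{X'} ⥲ Δ^temp_{Y'}` between certified data and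
every cusp `x` there is a cusp `y` with `γ(I_x ∩ Δ^temp) = δ I_y δ⁻¹ ∩ Δ^temp`, here with `δ = 1`.
Complement of abc-iut-w5-d040's single-cusp negative `exists_temperedCurve_not_isoPreservesCuspidalDecomp`;
consistency evidence only, not a curve. [cite: MochizukiSemiAnbd2006, Thm 6.5(iii) p.72] -/
theorem exists_principal_inertiaLeaf_cusped (p : ℕ) [Fact p.Prime] :
    ∃ (X : TemperedCurve p) (Ω : TemperedOrigin p), (∀ Y, Ω.IsHyperbolicCurveOrigin Y ↔ Y = X) ∧
      (∃ x : X.Pt, X.IsCusp x) ∧ (∃ g ∈ X.DeltaTemp, ∃ h ∈ X.DeltaTemp, g * h ≠ h * g) ∧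
      ∀ X' Y' : TemperedCurve p, Ω.IsHyperbolicCurveOrigin X' → Ω.IsHyperbolicCurveOrigin Y' →
        ∀ γ : X'.DeltaTemp ≃ₜ* Y'.DeltaTemp, ∀ x : X'.Pt, X'.IsCusp x →
          ∃ y : Y'.Pt, Y'.IsCusp y ∧ ∃ δ : ConjAct Y'.PiTemp,
            ((X'.inertia x).subgroupOf X'.DeltaTemp).map γ.toMulEquiv.toMonoidHom =
              (δ • Y'.inertia y).subgroupOf Y'.DeltaTemp := by
  obtain ⟨X, -, -, ⟨x₀⟩, hcusp, hnc, -, -, -, hsat⟩ := TemperedCurve.exists_saturatedCusps p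
  refine ⟨X, ⟨fun Y => Y = X⟩, fun Y => Iff.rfl, ⟨x₀, hcusp x₀⟩, hnc, ?_⟩
  intro X' Y' hX' hY' γ x _
  cases hX'
  cases hY'
  obtain ⟨y, hy⟩ := hsat γ x
  exact ⟨y, hcusp y, 1, by rw [one_smul]; exact hy⟩

end TemperedOrigin

end Literature.AnabelianGeometry.SemiGraphs

end
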